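import Summits.CriticalPhenomena.PercolationContinuityZ3.Theorems.PercNearOneGluingNoHeavyLowerTailSahiCombTriWAndSplitCertWeights

/-!
# Symmetric splitting certificates for AND-products: spanning-pair weights, the column half of Theorem W, and soundness of `(R*sym)`

Support file of the one-cut programme (crux `NoHeavyLowerTail`, stmt-CriticalPhenomena-4575; unit `prim-lf-1` gen 61, memo
`FROM-prim-lf-1-gen61-SYMSPLIT.md`).  Continuation of `…TriWAndSplitCert` (Theorem W, soundness of ROW-splitting certificates) and
`…TriWAndSplitCertWeights` (sources of admissible weights).

Gen 60 found that the row-only form of the splitting conjecture `(R*)` is false at `P₁ = maj5` (memo gen 60 §3b) while the SYMMETRIC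
form `(R*sym)` — row terms `σ ⊗ w` AND column terms `w' ⊗ σ'` — has no known failure.  This file supplies the kernel side of `(R*sym)`:
* **Spanning pairs are admissible** (`admissible_pairWt`, `admissible_top`): for `y₁, y₂ ∈ Q` with `y₁ ∪ y₂ = ⊤` the weight
  `[· = y₁] + [· = y₂]` is `Q`-admissible.  (Gen 61 shows on paper that these pair weights GENERATE the admissible cone: `𝒲(Q) = Π(Q)`; here only the easy
  containment is needed.)
* **Column half of Theorem W** (`aColSum_mono`, `aColSum_bounds`, `aColSum_pair`, `sum_kvec_mul_aColSum_nonneg`): for a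
  `P₁`-admissible weight `w'` the weighted COLUMN sum `α_{w'}(y) = Σ_{x∈P₁} w'(x)·δ_B(x⊔y)` is a bounded integer `K`-vector on the second
  block, hence pairs non-negatively with every bounded integer `K`-vector `σ'` on a good `Q` (block swap `Equiv.sumComm` + the row versions).
* **Soundness of symmetric splitting certificates** (`corP_andProd_nonneg_of_symSplit`): if `P₁` and `Q` are antipode-free up-sets with
  `Cor ≥ 0` and the `δ`-vector of a family `A` splits on `P₁ × Q` as
  `δ_A(x⊔y) = Σ_i σ_i(x)·w_i(y) + Σ_j w'_j(x)·σ'_j(y) + ρ(x⊔y) + (inflow − outflow of an upward transport)(x⊔y)`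
  with bounded integer `K`-vectors `σ_i` on `P₁`, `σ'_j` on `Q`, `Q`-admissible `w_i`, `P₁`-admissible `w'_j`, an increasing `ρ` and an upward
  transport `c`, then `Cor_{P₁∧Q}(A,B) ≥ 0` for EVERY up-set `B`.
HONEST LABEL: complete proofs, std axioms; infrastructure (no new block is certified here). [this work]
-/

namespace Summit.CriticalPhenomena.PercolationContinuityZ3.Theorems

namespace FiveUpSet

open Finset

variable {γ₁ γ₂ : Type} [DecidableEq γ₁] [Fintype γ₁] [DecidableEq γ₂] [Fintype γ₂]

/-! ### Spanning pairs are admissible weights -/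

omit [Fintype γ₂] in
/-- Summing against the pair weight `[· = y₁] + [· = y₂]` (as a `ℕ`-valued weight, cast to `ℤ`) evaluates at the two points. [this work] -/
theorem sum_pairWt_mul (Q : Finset (Finset γ₂)) {y₁ y₂ : Finset γ₂} (h₁ : y₁ ∈ Q) (h₂ : y₂ ∈ Q) (f : Finset γ₂ → ℤ) :
    ∑ y ∈ Q, (((if y = y₁ then 1 else 0) + (if y = y₂ then 1 else 0) : ℕ) : ℤ) * f y = f y₁ + f y₂ := by
  have e : ∀ y ∈ Q, (((if y = y₁ then 1 else 0) + (if y = y₂ then 1 else 0) : ℕ) : ℤ) * f y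
      = (if y = y₁ then f y else 0) + (if y = y₂ then f y else 0) := by
    intro y _
    push_cast
    rw [add_mul]
    congr 1 <;> split_ifs <;> simp
  rw [sum_congr rfl e, sum_add_distrib, sum_ite_eq' Q y₁ f, sum_ite_eq' Q y₂ f, if_pos h₁, if_pos h₂]

/-- **Spanning pairs are admissible**: for `y₁, y₂ ∈ Q` with `y₁ ∪ y₂ = ⊤`, the weight `[· = y₁] + [· = y₂]` is `Q`-admissible:
`Σ_{y∈Q} w(y)([y∈S] − [yᶜ∈S]) = [y₁∈S] + [y₂∈S] − [y₁ᶜ∈S] − [y₂ᶜ∈S] ≥ 0` for every up-set `S` (as `y₂ᶜ ⊆ y₁`, `y₁ᶜ ⊆ y₂`).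
(On paper, gen 61: these pair weights generate the whole admissible cone.) [this work] -/
theorem admissible_pairWt {Q : Finset (Finset γ₂)} {y₁ y₂ : Finset γ₂} (h₁ : y₁ ∈ Q) (h₂ : y₂ ∈ Q) (hsp : y₁ ∪ y₂ = univ)
    (S : Finset (Finset γ₂)) (hS : IsUpperSet (S : Set (Finset γ₂))) :
    0 ≤ ∑ y ∈ Q, ((fun y => ((if y = y₁ then 1 else 0) + (if y = y₂ then 1 else 0) : ℕ)) y : ℤ) * (ind S y - ind S yᶜ) := by
  rw [sum_pairWt_mul Q h₁ h₂]
  have hc₁ : y₁ᶜ ⊆ y₂ := by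
    intro a ha; rw [mem_compl] at ha
    have := mem_univ a; rw [← hsp, mem_union] at this; tauto
  have hc₂ : y₂ᶜ ⊆ y₁ := by
    intro a ha; rw [mem_compl] at ha
    have := mem_univ a; rw [← hsp, mem_union] at this; tauto
  have e₁ := ind_mono_pt hS hc₁
  have e₂ := ind_mono_pt hS hc₂
  linarith

/-- The top point alone is admissible (`[· = ⊤]`, half of the spanning pair `(⊤, ⊤)`). [this work] -/
theorem admissible_top {Q : Finset (Finset γ₂)} (htop : (univ : Finset γ₂) ∈ Q)
    (S : Finset (Finset γ₂)) (hS : IsUpperSet (S : Set (Finset γ₂))) :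
    0 ≤ ∑ y ∈ Q, ((fun y => if y = (univ : Finset γ₂) then (1 : ℕ) else 0) y : ℤ) * (ind S y - ind S yᶜ) := by
  have e : ∀ y ∈ Q, ((fun y => if y = (univ : Finset γ₂) then (1 : ℕ) else 0) y : ℤ) * (ind S y - ind S yᶜ)
      = if y = univ then (ind S y - ind S yᶜ) else 0 := by
    intro y _
    by_cases h : y = univ <;> simp [h]
  rw [sum_congr rfl e, sum_ite_eq' Q univ, if_pos htop]
  have h1 := ind_mono_pt hS (subset_univ ((univ : Finset γ₂)ᶜ))
  linarith

/-! ### The column half of Theorem W (block swap of the row half) -/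

/-- The weighted column sum is the weighted row sum of the block-swapped data. [this work] -/
theorem aColSum_eq_swap (w' : Finset γ₁ → ℕ) (B : Finset (Finset (γ₁ ⊕ γ₂))) (P₁ : Finset (Finset γ₁)) (y : Finset γ₂) :
    ∑ x ∈ P₁, (w' x : ℤ) * sgnDiff B (refl B) (x.disjSum y)
      = ∑ x ∈ P₁, (w' x : ℤ) * sgnDiff (famMap (Equiv.sumComm γ₁ γ₂) B) (refl (famMap (Equiv.sumComm γ₁ γ₂) B)) (y.disjSum x) :=
  sum_congr rfl fun x _ => by rw [sgnDiff_famMap_sumComm]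

/-- Column half of Theorem W, monotonicity: `α_{w'}` is increasing in `y`. [this work] -/
theorem aColSum_mono (w' : Finset γ₁ → ℕ) {B : Finset (Finset (γ₁ ⊕ γ₂))} (hB : IsUpperSet (B : Set (Finset (γ₁ ⊕ γ₂))))
    (P₁ : Finset (Finset γ₁)) {y y' : Finset γ₂} (h : y ⊆ y') :
    ∑ x ∈ P₁, (w' x : ℤ) * sgnDiff B (refl B) (x.disjSum y) ≤ ∑ x ∈ P₁, (w' x : ℤ) * sgnDiff B (refl B) (x.disjSum y') := by
  rw [aColSum_eq_swap, aColSum_eq_swap]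
  exact aRowSum_mono w' (isUpperSet_famMap _ hB) P₁ h

/-- Column half of Theorem W, bounds: `|α_{w'}(y)| ≤ Σ_{x∈P₁} w'(x)`. [this work] -/
theorem aColSum_bounds (w' : Finset γ₁ → ℕ) (B : Finset (Finset (γ₁ ⊕ γ₂))) (P₁ : Finset (Finset γ₁)) (y : Finset γ₂) :
    -((∑ x ∈ P₁, w' x : ℕ) : ℤ) ≤ ∑ x ∈ P₁, (w' x : ℤ) * sgnDiff B (refl B) (x.disjSum y) ∧
      ∑ x ∈ P₁, (w' x : ℤ) * sgnDiff B (refl B) (x.disjSum y) ≤ ((∑ x ∈ P₁, w' x : ℕ) : ℤ) := by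
  rw [aColSum_eq_swap]
  exact aRowSum_bounds w' _ P₁ y

/-- **Column half of Theorem W, pair condition**: for a `P₁`-admissible weight `w'` and up-set `B`: `y ∪ y' = ⊤ ⟹ α_{w'}(y) + α_{w'}(y') ≥ 0`.
[this work] -/
theorem aColSum_pair {w' : Finset γ₁ → ℕ} {P₁ : Finset (Finset γ₁)}
    (hw' : ∀ S : Finset (Finset γ₁), IsUpperSet (S : Set (Finset γ₁)) → 0 ≤ ∑ x ∈ P₁, (w' x : ℤ) * (ind S x - ind S xᶜ))
    {B : Finset (Finset (γ₁ ⊕ γ₂))} (hB : IsUpperSet (B : Set (Finset (γ₁ ⊕ γ₂)))) {y y' : Finset γ₂} (h : y ∪ y' = univ) :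
    0 ≤ ∑ x ∈ P₁, (w' x : ℤ) * sgnDiff B (refl B) (x.disjSum y) + ∑ x ∈ P₁, (w' x : ℤ) * sgnDiff B (refl B) (x.disjSum y') := by
  rw [aColSum_eq_swap, aColSum_eq_swap]
  exact aRowSum_pair hw' (isUpperSet_famMap _ hB) h

/-- **Column half of Theorem W, conclusion**: on an antipode-free up-set `Q` with `Cor_Q ≥ 0`, a bounded integer `K`-vector `σ'` pairs
non-negatively with the admissible column sum `α_{w'}`. [this work] -/
theorem sum_kvec_mul_aColSum_nonneg {Q : Finset (Finset γ₂)} (hQ : IsUpperSet (Q : Set (Finset γ₂))) (hdQ : Disjoint Q (refl Q))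
    (hcorQ : ∀ U V : Finset (Finset γ₂), IsUpperSet (U : Set (Finset γ₂)) → IsUpperSet (V : Set (Finset γ₂)) → 0 ≤ corP Q U V)
    {m' : ℕ} {σ' : Finset γ₂ → ℤ} (hσb : ∀ y ∈ Q, -(m' : ℤ) ≤ σ' y ∧ σ' y ≤ m')
    (hσm : ∀ y ∈ Q, ∀ y' ∈ Q, y ⊆ y' → σ' y ≤ σ' y') (hσp : ∀ y ∈ Q, ∀ y' ∈ Q, y ∪ y' = univ → 0 ≤ σ' y + σ' y')
    {w' : Finset γ₁ → ℕ} {P₁ : Finset (Finset γ₁)}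
    (hw' : ∀ S : Finset (Finset γ₁), IsUpperSet (S : Set (Finset γ₁)) → 0 ≤ ∑ x ∈ P₁, (w' x : ℤ) * (ind S x - ind S xᶜ))
    {B : Finset (Finset (γ₁ ⊕ γ₂))} (hB : IsUpperSet (B : Set (Finset (γ₁ ⊕ γ₂)))) :
    0 ≤ ∑ y ∈ Q, σ' y * ∑ x ∈ P₁, (w' x : ℤ) * sgnDiff B (refl B) (x.disjSum y) :=
  sum_mul_nonneg_of_bounded hQ hdQ hcorQ m' σ' hσb hσm hσp (∑ x ∈ P₁, w' x)
    (fun y => ∑ x ∈ P₁, (w' x : ℤ) * sgnDiff B (refl B) (x.disjSum y)) (fun y _ => aColSum_bounds w' B P₁ y)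
    (fun _ _ _ _ h => aColSum_mono w' hB P₁ h) (fun _ _ _ _ h => aColSum_pair hw' hB h)

/-! ### Soundness of symmetric splitting certificates -/

/-- **Soundness of `(R*sym)`-certificates.**  Let `P₁ ⊆ 2^{γ₁}` and `Q ⊆ 2^{γ₂}` be antipode-free up-sets with `Cor ≥ 0` on up-set pairs, and
`A` any family on the product cube.  Suppose the `δ`-vector of `A` splits on `P₁ × Q` as
`δ_A(x⊔y) = Σ_i σ_i(x)·w_i(y) + Σ_j w'_j(x)·σ'_j(y) + ρ(x⊔y) + Σ_{p ∈ P₁∧Q} c(p, x⊔y) − Σ_{q ∈ P₁∧Q} c(x⊔y, q)`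
with bounded integer `K`-vectors `σ_i` on `P₁` and `σ'_j` on `Q`, `Q`-admissible weights `w_i`, `P₁`-admissible weights `w'_j`, an increasing
`ρ : 2^{γ₁⊕γ₂} → ℕ`, and an upward transport `c` (`c p q ≠ 0 ⟹ p ⊆ q`).  Then `Cor_{P₁∧Q}(A,B) ≥ 0` for every up-set `B`. [this work] -/
theorem corP_andProd_nonneg_of_symSplit {ι ι' : Type} [Fintype ι] [DecidableEq ι] [Fintype ι'] [DecidableEq ι']
    {P₁ : Finset (Finset γ₁)} (hP : IsUpperSet (P₁ : Set (Finset γ₁))) (hd : Disjoint P₁ (refl P₁))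
    (hcor : ∀ U V : Finset (Finset γ₁), IsUpperSet (U : Set (Finset γ₁)) → IsUpperSet (V : Set (Finset γ₁)) → 0 ≤ corP P₁ U V)
    {Q : Finset (Finset γ₂)} (hQ : IsUpperSet (Q : Set (Finset γ₂))) (hdQ : Disjoint Q (refl Q))
    (hcorQ : ∀ U V : Finset (Finset γ₂), IsUpperSet (U : Set (Finset γ₂)) → IsUpperSet (V : Set (Finset γ₂)) → 0 ≤ corP Q U V)
    (A : Finset (Finset (γ₁ ⊕ γ₂)))
    (m : ℕ) (σ : ι → Finset γ₁ → ℤ) (hσb : ∀ i, ∀ x ∈ P₁, -(m : ℤ) ≤ σ i x ∧ σ i x ≤ m)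
    (hσm : ∀ i, ∀ x ∈ P₁, ∀ x' ∈ P₁, x ⊆ x' → σ i x ≤ σ i x') (hσp : ∀ i, ∀ x ∈ P₁, ∀ x' ∈ P₁, x ∪ x' = univ → 0 ≤ σ i x + σ i x')
    (w : ι → Finset γ₂ → ℕ)
    (hw : ∀ i, ∀ S : Finset (Finset γ₂), IsUpperSet (S : Set (Finset γ₂)) → 0 ≤ ∑ y ∈ Q, (w i y : ℤ) * (ind S y - ind S yᶜ))
    (m' : ℕ) (σ' : ι' → Finset γ₂ → ℤ) (hσb' : ∀ j, ∀ y ∈ Q, -(m' : ℤ) ≤ σ' j y ∧ σ' j y ≤ m')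
    (hσm' : ∀ j, ∀ y ∈ Q, ∀ y' ∈ Q, y ⊆ y' → σ' j y ≤ σ' j y') (hσp' : ∀ j, ∀ y ∈ Q, ∀ y' ∈ Q, y ∪ y' = univ → 0 ≤ σ' j y + σ' j y')
    (w' : ι' → Finset γ₁ → ℕ)
    (hw' : ∀ j, ∀ S : Finset (Finset γ₁), IsUpperSet (S : Set (Finset γ₁)) → 0 ≤ ∑ x ∈ P₁, (w' j x : ℤ) * (ind S x - ind S xᶜ))
    (ρ : Finset (γ₁ ⊕ γ₂) → ℕ) (hρ : ∀ t t' : Finset (γ₁ ⊕ γ₂), t ⊆ t' → ρ t ≤ ρ t')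
    (c : Finset (γ₁ ⊕ γ₂) → Finset (γ₁ ⊕ γ₂) → ℕ) (hc : ∀ p q, c p q ≠ 0 → p ⊆ q)
    (hsplit : ∀ x ∈ P₁, ∀ y ∈ Q, sgnDiff A (refl A) (x.disjSum y)
      = ∑ i, σ i x * (w i y : ℤ) + ∑ j, (w' j x : ℤ) * σ' j y + ρ (x.disjSum y)
        + ((∑ p ∈ andProd P₁ Q, (c p (x.disjSum y) : ℤ)) - ∑ q ∈ andProd P₁ Q, (c (x.disjSum y) q : ℤ)))
    {B : Finset (Finset (γ₁ ⊕ γ₂))} (hB : IsUpperSet (B : Set (Finset (γ₁ ⊕ γ₂)))) :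
    0 ≤ corP (andProd P₁ Q) A B := by
  -- the row terms
  have hK : 0 ≤ ∑ x ∈ P₁, ∑ y ∈ Q, (∑ i, σ i x * (w i y : ℤ)) * sgnDiff B (refl B) (x.disjSum y) := by
    have e : ∑ x ∈ P₁, ∑ y ∈ Q, (∑ i, σ i x * (w i y : ℤ)) * sgnDiff B (refl B) (x.disjSum y)
        = ∑ i, ∑ x ∈ P₁, σ i x * ∑ y ∈ Q, (w i y : ℤ) * sgnDiff B (refl B) (x.disjSum y) := by
      have s1 : ∑ x ∈ P₁, ∑ y ∈ Q, (∑ i, σ i x * (w i y : ℤ)) * sgnDiff B (refl B) (x.disjSum y)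
          = ∑ x ∈ P₁, ∑ y ∈ Q, ∑ i, σ i x * ((w i y : ℤ) * sgnDiff B (refl B) (x.disjSum y)) :=
        sum_congr rfl fun x _ => sum_congr rfl fun y _ => by rw [Finset.sum_mul]; exact sum_congr rfl fun i _ => by ring
      have s2 : ∑ x ∈ P₁, ∑ y ∈ Q, ∑ i, σ i x * ((w i y : ℤ) * sgnDiff B (refl B) (x.disjSum y))
          = ∑ x ∈ P₁, ∑ i, ∑ y ∈ Q, σ i x * ((w i y : ℤ) * sgnDiff B (refl B) (x.disjSum y)) :=
        sum_congr rfl fun x _ => Finset.sum_comm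
      rw [s1, s2, Finset.sum_comm]
      exact sum_congr rfl fun i _ => sum_congr rfl fun x _ => by rw [Finset.mul_sum]
    rw [e]
    exact sum_nonneg fun i _ => sum_kvec_mul_aRowSum_nonneg hP hd hcor (hσb i) (hσm i) (hσp i) (hw i) hB
  -- the column terms
  have hK' : 0 ≤ ∑ x ∈ P₁, ∑ y ∈ Q, (∑ j, (w' j x : ℤ) * σ' j y) * sgnDiff B (refl B) (x.disjSum y) := by
    have e : ∑ x ∈ P₁, ∑ y ∈ Q, (∑ j, (w' j x : ℤ) * σ' j y) * sgnDiff B (refl B) (x.disjSum y)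
        = ∑ j, ∑ y ∈ Q, σ' j y * ∑ x ∈ P₁, (w' j x : ℤ) * sgnDiff B (refl B) (x.disjSum y) := by
      have s1 : ∑ x ∈ P₁, ∑ y ∈ Q, (∑ j, (w' j x : ℤ) * σ' j y) * sgnDiff B (refl B) (x.disjSum y)
          = ∑ x ∈ P₁, ∑ y ∈ Q, ∑ j, σ' j y * ((w' j x : ℤ) * sgnDiff B (refl B) (x.disjSum y)) :=
        sum_congr rfl fun x _ => sum_congr rfl fun y _ => by rw [Finset.sum_mul]; exact sum_congr rfl fun j _ => by ring
      have s2 : ∑ x ∈ P₁, ∑ y ∈ Q, ∑ j, σ' j y * ((w' j x : ℤ) * sgnDiff B (refl B) (x.disjSum y))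
          = ∑ j, ∑ x ∈ P₁, ∑ y ∈ Q, σ' j y * ((w' j x : ℤ) * sgnDiff B (refl B) (x.disjSum y)) := by
        rw [show (∑ x ∈ P₁, ∑ y ∈ Q, ∑ j, σ' j y * ((w' j x : ℤ) * sgnDiff B (refl B) (x.disjSum y)))
            = ∑ x ∈ P₁, ∑ j, ∑ y ∈ Q, σ' j y * ((w' j x : ℤ) * sgnDiff B (refl B) (x.disjSum y)) from
          sum_congr rfl fun x _ => Finset.sum_comm, Finset.sum_comm]
      have s3 : ∀ j, ∑ x ∈ P₁, ∑ y ∈ Q, σ' j y * ((w' j x : ℤ) * sgnDiff B (refl B) (x.disjSum y))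
          = ∑ y ∈ Q, σ' j y * ∑ x ∈ P₁, (w' j x : ℤ) * sgnDiff B (refl B) (x.disjSum y) := by
        intro j
        rw [Finset.sum_comm]
        exact sum_congr rfl fun y _ => by rw [Finset.mul_sum]
      rw [s1, s2]
      exact sum_congr rfl fun j _ => s3 j
    rw [e]
    exact sum_nonneg fun j _ => sum_kvec_mul_aColSum_nonneg hQ hdQ hcorQ (hσb' j) (hσm' j) (hσp' j) (hw' j) hB
  -- the increasing part
  have hR : 0 ≤ ∑ t ∈ andProd P₁ Q, (ρ t : ℤ) * sgnDiff B (refl B) t := by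
    obtain ⟨R, hR⟩ : ∃ R : ℕ, ∀ t, ρ t ≤ R :=
      ⟨univ.sup ρ, fun t => le_sup (mem_univ t)⟩
    exact sum_incr_mul_sgnDiff_nonneg (isUpperSet_andProd hP hQ) hB R ρ hR hρ
  -- the transport part
  have hM : 0 ≤ ∑ t ∈ andProd P₁ Q, sgnDiff B (refl B) t *
      ((∑ p ∈ andProd P₁ Q, (c p t : ℤ)) - ∑ q ∈ andProd P₁ Q, (c t q : ℤ)) := by
    rw [sum_flow_eq]
    exact sum_transport_nonneg hB c hc
  -- rewrite `Cor` through the certificate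
  rw [corP_andProd_eq_sum_sum]
  have e1 : ∑ x ∈ P₁, ∑ y ∈ Q, sgnDiff A (refl A) (x.disjSum y) * sgnDiff B (refl B) (x.disjSum y)
      = ∑ x ∈ P₁, ∑ y ∈ Q, (∑ i, σ i x * (w i y : ℤ)) * sgnDiff B (refl B) (x.disjSum y)
        + ∑ x ∈ P₁, ∑ y ∈ Q, (∑ j, (w' j x : ℤ) * σ' j y) * sgnDiff B (refl B) (x.disjSum y)
        + ∑ x ∈ P₁, ∑ y ∈ Q, ((ρ (x.disjSum y) : ℤ) * sgnDiff B (refl B) (x.disjSum y)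
          + sgnDiff B (refl B) (x.disjSum y) *
            ((∑ p ∈ andProd P₁ Q, (c p (x.disjSum y) : ℤ)) - ∑ q ∈ andProd P₁ Q, (c (x.disjSum y) q : ℤ))) := by
    rw [← sum_add_distrib, ← sum_add_distrib]
    refine sum_congr rfl fun x hx => ?_
    rw [← sum_add_distrib, ← sum_add_distrib]
    refine sum_congr rfl fun y hy => ?_
    rw [hsplit x hx y hy]
    ring
  have e2 : ∀ f : Finset (γ₁ ⊕ γ₂) → ℤ, ∑ x ∈ P₁, ∑ y ∈ Q, f (x.disjSum y) = ∑ t ∈ andProd P₁ Q, f t := by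
    intro f
    rw [andProd_eq_biUnion, sum_biUnion (pairwiseDisjoint_rows P₁ Q)]
    exact sum_congr rfl fun x _ => by rw [sum_map]; rfl
  rw [e1, e2 (fun t => (ρ t : ℤ) * sgnDiff B (refl B) t + sgnDiff B (refl B) t *
      ((∑ p ∈ andProd P₁ Q, (c p t : ℤ)) - ∑ q ∈ andProd P₁ Q, (c t q : ℤ))), sum_add_distrib]
  linarith


/-! ### Appendix (gen 61, second instalment): the neighbourhood-plus-point weight and the single-defect certificate

For `y₀ ∈ Q` the SPANNING NEIGHBOURHOOD of `y₀` in `Q` is `N(y₀) = {y ∈ Q | y₀ᶜ ⊆ y}` (the `y ∈ Q` with `y ∪ y₀ = ⊤`).  The weight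
`1_{N(y₀)} + [· = y₀]` is `Q`-admissible (memo gen 61 §1(c)); it is the weight of the explicit certificate of a single-defect tight unit
`1_{N(x₀)×N(y₀)} − e_{(x₀,y₀)} = ½[(1_{N(x₀)} − e_{x₀}) ⊗ (1_{N(y₀)} + [·=y₀]) + (1_{N(x₀)} + [·=x₀]) ⊗ (1_{N(y₀)} − e_{y₀})]` (memo §4). -/

/-- **The neighbourhood-plus-point weight is admissible**: for an up-set `Q` and `y₀ ∈ Q`, the weight `w(y) = [y₀ᶜ ⊆ y] + [y = y₀]` satisfies
`Σ_{y∈Q} w(y)([y∈S] − [yᶜ∈S]) ≥ 0` for every up-set `S`.  (Kleitman on the up-set `Q ∩ ↑y₀ᶜ`; in the only bad case `y₀ᶜ ∈ S ∌ y₀` every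
`y ⊇ y₀ᶜ` lies in `S` and no such `yᶜ ⊆ y₀` does, so the first part is `≥ #{⊤} = 1`.) [this work] -/
theorem admissible_nbhd_add_point {Q : Finset (Finset γ₂)} (hQ : IsUpperSet (Q : Set (Finset γ₂))) {y₀ : Finset γ₂} (hy₀ : y₀ ∈ Q)
    (S : Finset (Finset γ₂)) (hS : IsUpperSet (S : Set (Finset γ₂))) :
    0 ≤ ∑ y ∈ Q, ((fun y => (if y₀ᶜ ⊆ y then 1 else 0) + (if y = y₀ then 1 else 0) : Finset γ₂ → ℕ) y : ℤ) * (ind S y - ind S yᶜ) := by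
  have htop : (univ : Finset γ₂) ∈ Q := hQ (subset_univ y₀) hy₀
  -- split the weight
  have hsplit : ∑ y ∈ Q, ((fun y => (if y₀ᶜ ⊆ y then 1 else 0) + (if y = y₀ then 1 else 0) : Finset γ₂ → ℕ) y : ℤ) * (ind S y - ind S yᶜ)
      = ∑ y ∈ Q, (if y₀ᶜ ⊆ y then (ind S y - ind S yᶜ) else 0) + ∑ y ∈ Q, (if y = y₀ then (ind S y - ind S yᶜ) else 0) := by
    rw [← sum_add_distrib]
    refine sum_congr rfl fun y _ => ?_
    push_cast
    rw [add_mul]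
    congr 1 <;> split_ifs <;> simp
  rw [hsplit, sum_ite_eq' Q y₀, if_pos hy₀]
  -- the first part is Kleitman on the up-set `Q ∩ ↑y₀ᶜ`
  have hV : IsUpperSet ((univ.filter fun y : Finset γ₂ => y₀ᶜ ⊆ y : Finset (Finset γ₂)) : Set (Finset γ₂)) := by
    intro t t' htt' ht
    rw [mem_coe, mem_filter] at ht ⊢
    exact ⟨mem_univ _, ht.2.trans htt'⟩
  have e1 : ∑ y ∈ Q, (if y₀ᶜ ⊆ y then (ind S y - ind S yᶜ) else 0)
      = ∑ y ∈ Q, ind (univ.filter fun y : Finset γ₂ => y₀ᶜ ⊆ y) y * (ind S y - ind S yᶜ) := by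
    refine sum_congr rfl fun y _ => ?_
    unfold ind
    simp only [mem_filter, mem_univ, true_and]
    split_ifs <;> simp
  have k1 : 0 ≤ ∑ y ∈ Q, (if y₀ᶜ ⊆ y then (ind S y - ind S yᶜ) else 0) := by
    rw [e1]; exact admissible_ind_upset hQ hV S hS
  by_cases hbad : y₀ᶜ ∈ S ∧ y₀ ∉ S
  · -- every `y ∈ Q` with `y₀ᶜ ⊆ y` is in `S`, and `yᶜ ⊆ y₀ ∉ S`; the top alone gives `1`
    have hterm : ∀ y ∈ Q, (0 : ℤ) ≤ (if y₀ᶜ ⊆ y then (ind S y - ind S yᶜ) else 0) := by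
      intro y _
      split_ifs with h
      · have h1 : y ∈ S := hS h hbad.1
        have h2 : yᶜ ∉ S := fun hc => hbad.2 (hS (compl_le_iff_compl_le.1 h) hc)
        unfold ind; rw [if_pos h1, if_neg h2]; norm_num
      · exact le_refl _
    have hge : (if y₀ᶜ ⊆ (univ : Finset γ₂) then (ind S univ - ind S univᶜ) else 0) ≤
        ∑ y ∈ Q, (if y₀ᶜ ⊆ y then (ind S y - ind S yᶜ) else 0) :=
      single_le_sum hterm htop
    have htopval : (if y₀ᶜ ⊆ (univ : Finset γ₂) then (ind S univ - ind S univᶜ) else 0) = (1 : ℤ) := by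
      rw [if_pos (subset_univ _)]
      have h1 : (univ : Finset γ₂) ∈ S := hS (subset_univ _) hbad.1
      have h2 : (univ : Finset γ₂)ᶜ ∉ S := by
        intro hc; exact hbad.2 (hS (by rw [compl_univ]; exact empty_subset _) hc)
      unfold ind; rw [if_pos h1, if_neg h2]; norm_num
    have hy : -1 ≤ ind S y₀ - ind S y₀ᶜ := by
      have := ind_nonneg_le_one S y₀; have := ind_nonneg_le_one S y₀ᶜ; linarith
    linarith
  · have hy : 0 ≤ ind S y₀ - ind S y₀ᶜ := by
      unfold ind
      by_cases h1 : y₀ ∈ S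
      · rw [if_pos h1]; split_ifs <;> norm_num
      · have h2 : y₀ᶜ ∉ S := fun hc => hbad ⟨hc, h1⟩
        rw [if_neg h1, if_neg h2]; norm_num
    linarith

end FiveUpSet

end Summit.CriticalPhenomena.PercolationContinuityZ3.Theorems
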